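import Summits.QuantumFields.YangMills.Theorems.BalabanUVNodesK0Stub1CombColumnLetter

/-!
# K0⁷ STUB 1 (`stub_prop8StepCoP13`), sub-target S4a — **THE TERRITORY OF THE COLUMN OF THE GAUGE MAP `T`** (input of the WEIGHTED sup letter of the corrected current):
# the centres reading a fine bond `b′` have the territory `j(b′₋)`, and territories of lattice neighbours differ by at most one (collar property)

Cell `pub-ymgap`, width seat `pub-ymgap-k0-s1-w1` g6 (CLAIM-2, file 1∕2; ASKED by k0-s1-w2 g4 ■ «the S4b bookkeeping absorbs your constant only through a WEIGHTED edition
`w₃(b′)‖RᵀW b′‖ ≤ C′·sup_b w₃(b)‖W b‖ — true by your locality … level gap ≤ 1 under the collar»).  `--kind proof --supports stmt-QuantumFields-20541 --as helper`; count-neutral.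
Built on `…K0Stub1CombColumnLetter` (p624703).  File 2∕2 = `…K0Stub1CorrectedCurrentWeightedLetter`.
[15] = [Balaban1985Variational]; [B6] = [Balaban1984PropagatorsII]; [I] = [Balaban1987RG1].

WHY.  The heart consumes the current through Prop. 4's WEIGHTED slot `w₃(b)·‖W(Y)(b)‖ ≤ C₄r²` (p604735 `hWq`; `IsLevWeight`: `w_m(b) = (L^{levOf(b₋)}·η)^m`, `levOf` = the
territory level of [B6] (2.4), UST `FlatCubeLevels.levOf_inOm_eq_iff`).  To pass the column letter of `T` (p624703 `exists_column_of_dichotomy`) through these weights one needs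
to compare the territory of `b′₋` with the territories of the bonds at the centres reading `b′`: (i) a centre `x` of a touched block CONTAINING `b′₋` has the SAME territory as
`b′₋` (the three cases of p616754 `depth_cases_of_touched`: Λ-site ∕ outer boundary — the central sub-block is an `Ω_{j₀}`-site by the collar and is not deep — ∕ inner crossing,
collapsed to `j₀ = j + 1` by p624703 `level_of_touched`); (ii) LATTICE NEIGHBOURS have territories differing by at most one (iterated block adjacency + the boundary lemma p624703
`not_deep_of_adjacent_not_mem`).

WHAT IS PROVED (sorry-free; no definition; axioms standard; `M = M_N(ℂ)`).
* §1 ★ `lamSite_of_touched_centre`, ★★ `exists_column_support_of_dichotomy` (p624703's column letter PLUS: `c(x) ≠ 0 ⇒ B^{j₀}(x) ∈ Λ_{j₀}` for the territory `j₀` of `b′₋`).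
* §2 `iterBlockOf_adjacent`, ★ `territory_le_succ_of_adjacent` (`j(z) ≤ j(x) + 1` for lattice neighbours), `levOf_le_succ_of_adjacent` (the same in `levOf` letters).

HONEST SCOPE.  Lattice bookkeeping over kernel-checked identities ([B6] (2.1)–(2.4) nesting, the UST collar); NO estimate of Bałaban's asserted; `stub_prop8StepCoP13` ∕ K0⁷ NOT closed;
N07 NOT discharged; counts unmoved (28∕28 · 5∕27); one finite 𝕋⁴ programme at fixed ε — R4 closes the conditional finite-𝕋⁴ rung `BalabanLadder.UV` only, never the summit; the YM
mass gap (Clay) is NOT proved by any of this; nothing continuum ∕ ℝ⁴ ∕ OS.  No `sorry`, no `def`, no `instance`, no `notation`.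

References: [B6] (2.1)–(2.4) p.224; [15] (98) p.292, (152) p.301; [I] (0.1)–(0.3) pp.251–252.
-/

set_option autoImplicit false
noncomputable section
open scoped BigOperators Matrix Matrix.Norms.L2Operator

namespace Summit.QuantumFields.YangMills.Theorems.K0Stub1ColumnTerritory

open Literature.MathematicalPhysics.QuantumFieldTheory.Balaban1983to89
open LatticeFieldCalculus (bondAvgIter)
open BlockAveragingEMLLinearised (combMean)
open B5Eq118OneStroke (iterBlockOf iterBlockOf_zero iterBlockOf_succ)
open B15DeterminingSets (embIter)
open B11Eq115Space (levOf)
open B6SectADomainsV1 (Domains)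
open Summit.QuantumFields.YangMills.Theorems.ChartHInv (exists_combFamily)
open Summit.QuantumFields.YangMills.Theorems.K0Stub1TouchedCentresOfDomains (depth_cases_of_touched inOm_of_le_depth not_inOm_of_depth_lt)
open Summit.QuantumFields.YangMills.Theorems.K0Stub1CombColumnLetter (exists_combFamily_smul_const' combFamily_eq_zero_of_vanish blockOf_adjacent_of_ne
  not_deep_of_adjacent_not_mem level_of_touched)

variable {P : Params} {N : ℕ}

/-! ## §1  The centres reading a fine bond have the territory of its initial point -/

section Support

variable (D : Domains P)
  (hcollar : ∀ (i : ℕ) (e : PBond P (i + 1)), D.LamBond (i + 1) e → ∀ z : Site P i, (blockOf z = e.src ∨ blockOf z = e.tgt) → z ∈ D.Om i)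
  {I : (j : ℕ) → PBond P j → Prop}
  (hI₁ : ∀ (j : ℕ) (b : PBond P j), I j b → D.LamSite j b.src ∨ D.LamSite j b.tgt)

include hcollar hI₁ in
/-- ★ **THE CENTRE OF A TOUCHED BLOCK OVER `x₀` HAS THE TERRITORY OF `x₀`**: if `Bʲ(x₀)` is an end-point of an index bond of level `j` and `B^{j₀}(x₀) ∈ Λ_{j₀}`, then the
centre `x = embIter j (Bʲ(x₀))` satisfies `B^{j₀}(x) ∈ Λ_{j₀}` — in the three cases of p616754 `depth_cases_of_touched`: `j = j₀` (`B^{j₀}(x) = Bʲ(x₀)`); outer `j = j₀ + 1`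
(`B^{j₀}(x)` is the central sub-block of a (2.3)-bond's end-point: in `Ω_{j₀}` by the collar, not deep); inner `j + 1 = j₀` (`B^{j₀}(x) = B(Bʲ(x₀)) = B^{j₀}(x₀)`).
[cite: Balaban1984PropagatorsII, (2.1)-(2.4) p.224; Balaban1987RG1, (0.1) p.251] -/
theorem lamSite_of_touched_centre {j : ℕ} {b : PBond P j} (hb : I j b) {x₀ : Site P 0}
    (hx : iterBlockOf j x₀ = b.src ∨ iterBlockOf j x₀ = b.tgt) {j₀ : ℕ} (hj₀ : D.LamSite j₀ (iterBlockOf j₀ x₀)) :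
    D.LamSite j₀ (iterBlockOf j₀ (embIter j (iterBlockOf j x₀))) := by
  have hjP : j ≤ P.m + P.K := by rcases hI₁ j b hb with h | h <;> exact (D.le_of_lamSite h).trans D.hk
  rcases depth_cases_of_touched D hcollar hI₁ hb hx hj₀ with h | ⟨h, hout, hLB⟩ | ⟨h, -⟩
  · subst h
    rw [Node00.iterBlockOf_embIter _ hjP]
    exact hj₀
  · subst h
    have hj₀P : j₀ ≤ P.m + P.K := by omega
    have hctr : iterBlockOf j₀ (embIter (j₀ + 1) (iterBlockOf (j₀ + 1) x₀)) = emb (iterBlockOf (j₀ + 1) x₀) :=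
      Node00.iterBlockOf_embIter j₀ hj₀P (emb (iterBlockOf (j₀ + 1) x₀))
    rw [hctr]
    refine ⟨hcollar j₀ b hLB _ (by rw [Site.blockOf_emb hjP]; exact hx), fun hdeep => hout ?_⟩
    have hd : blockOf (emb (iterBlockOf (j₀ + 1) x₀)) ∈ D.Om (j₀ + 1) := hdeep
    rwa [Site.blockOf_emb hjP] at hd
  · have hlev := level_of_touched D hcollar hI₁ hb hx hj₀
    have hj1 : j + 1 = j₀ := by omega
    subst hj1
    rw [iterBlockOf_succ, Node00.iterBlockOf_embIter j hjP, ← iterBlockOf_succ]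
    exact hj₀

include hcollar hI₁ in
/-- ★★ **THE COLUMN OF THE GAUGE MAP WITH ITS SUPPORT** (p624703 `exists_column_of_dichotomy` refined): for any `T` with the dichotomy clause and any field `Z` supported on one
fine bond `b′`, `(TZ)(x) = c(x)•Z(b′)` with `Σ_x |c(x)| ≤ 6(d+2)L`, and EVERY `x` WITH `c(x) ≠ 0` HAS THE TERRITORY OF `b′₋` (`B^{j₀}(b′₋) ∈ Λ_{j₀} ⇒ B^{j₀}(x) ∈ Λ_{j₀}`).
[cite: Balaban1985Variational, (44)-(47) p.285, (98) p.292; Balaban1985Averaging, (62) p.28; Balaban1984PropagatorsII, (2.1)-(2.4) p.224] -/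
theorem exists_column_support_of_dichotomy (hd : 2 ≤ P.d)
    (T : (PBond P 0 → Matrix (Fin N) (Fin N) ℂ) → Site P 0 → Matrix (Fin N) (Fin N) ℂ)
    (hT : ∀ (Λ : (i : ℕ) → (PBond P 0 → Matrix (Fin N) (Fin N) ℂ) → Site P i → Matrix (Fin N) (Fin N) ℂ),
      (∀ Y y, Λ 0 Y y = 0) →
      (∀ (i : ℕ) (Y : PBond P 0 → Matrix (Fin N) (Fin N) ℂ) (y : Site P (i + 1)),
        Λ (i + 1) Y y = (P.L ^ i : ℕ) • combMean (bondAvgIter i Y) y + Λ i Y (emb y)) →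
      ∀ (Z : PBond P 0 → Matrix (Fin N) (Fin N) ℂ) (x : Site P 0), T Z x = 0 ∨
        ∃ (j : ℕ) (b : PBond P j) (y : Site P j), I j b ∧ (y = b.src ∨ y = b.tgt) ∧ embIter j y = x ∧ T Z x = Λ j Z y)
    (b' : PBond P 0) (Z : PBond P 0 → Matrix (Fin N) (Fin N) ℂ) (hZ : ∀ b, b ≠ b' → Z b = 0) :
    ∃ c : Site P 0 → ℝ, (∀ x, T Z x = c x • Z b') ∧ ∑ x, |c x| ≤ 6 * (((P.d + 2) * P.L : ℕ) : ℝ) ∧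
      ∀ x, c x ≠ 0 → ∀ j₀, D.LamSite j₀ (iterBlockOf j₀ b'.src) → D.LamSite j₀ (iterBlockOf j₀ x) := by
  classical
  obtain ⟨Λ, hΛ0, hΛs⟩ := exists_combFamily (P := P) (n := Fin N)
  let f : PBond P 0 → ℝ := fun b => if b = b' then 1 else 0
  have hf0 : ∀ b, 0 ≤ f b := fun b => by simp only [f]; split_ifs <;> norm_num
  have hf1 : ∑ b, f b ≤ 1 := by simp [f]
  have hZf : Z = fun b => f b • Z b' := by
    funext b
    by_cases hb : b = b'
    · subst hb; simp [f]
    · simp [f, hb, hZ b hb]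
  obtain ⟨j₀, -, hj₀⟩ := D.exists_lamSite_iterBlockOf b'.src
  let S : Finset (Site P 0) := ({j₀ - 1, j₀, j₀ + 1} : Finset ℕ).image fun j => embIter j (iterBlockOf j b'.src)
  have hS : S.card ≤ 3 := Finset.card_image_le.trans Finset.card_le_three
  set K₁ : ℝ := 2 * (((P.d + 2) * P.L : ℕ) : ℝ) with hK₁
  have hK₁0 : 0 ≤ K₁ := by positivity
  have hpt : ∀ x, ∃ r : ℝ, T Z x = r • Z b' ∧ (|r| ≤ if x ∈ S then K₁ else 0) ∧
      (r ≠ 0 → D.LamSite j₀ (iterBlockOf j₀ x)) := by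
    intro x
    have hif : (0 : ℝ) ≤ if x ∈ S then K₁ else 0 := by split_ifs <;> [exact hK₁0; exact le_rfl]
    rcases hT Λ hΛ0 hΛs Z x with h0 | ⟨j, b, y, hb, hyb, hyx, hTeq⟩
    · exact ⟨0, by rw [h0, zero_smul], by rw [abs_zero]; exact hif, fun h => absurd rfl h⟩
    have hjP : j ≤ P.m + P.K := by
      rcases hI₁ j b hb with h | h <;> exact (D.le_of_lamSite h).trans D.hk
    by_cases hblk : iterBlockOf j b'.src = y
    · have hlev := level_of_touched D hcollar hI₁ hb (x := b'.src) (by rw [hblk]; exact hyb) hj₀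
      have hxS : x ∈ S := by
        refine Finset.mem_image.mpr ⟨j, ?_, by rw [hblk, hyx]⟩
        simp only [Finset.mem_insert, Finset.mem_singleton]
        omega
      obtain ⟨r, hr, hrb⟩ := exists_combFamily_smul_const' Λ hΛ0 hΛs hd f hf0 hf1 (Z b') hjP y
      refine ⟨r, ?_, by rw [if_pos hxS]; exact hrb, fun _ => ?_⟩
      · rw [hTeq]
        conv_lhs => rw [hZf]
        exact hr
      · rw [← hyx, ← hblk]
        exact lamSite_of_touched_centre D hcollar hI₁ hb (x₀ := b'.src) (by rw [hblk]; exact hyb) hj₀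
    · have hzero : Λ j Z y = 0 :=
        combFamily_eq_zero_of_vanish Λ hΛ0 hΛs j hjP Z y fun b h1 _ => hZ b fun hbb => hblk (hbb ▸ h1)
      exact ⟨0, by rw [hTeq, hzero, zero_smul], by rw [abs_zero]; exact hif, fun h => absurd rfl h⟩
  choose c hc hcb hct using hpt
  refine ⟨c, hc, ?_, fun x hx j₀' hj₀' => ?_⟩
  · calc ∑ x, |c x| ≤ ∑ x, (if x ∈ S then K₁ else 0) := Finset.sum_le_sum fun x _ => hcb x
      _ = ∑ x ∈ S, K₁ := by rw [← Finset.sum_filter]; congr 1; ext x; simp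
      _ = S.card * K₁ := by rw [Finset.sum_const, nsmul_eq_mul]
      _ ≤ 3 * K₁ := mul_le_mul_of_nonneg_right (by exact_mod_cast hS) hK₁0
      _ = 6 * (((P.d + 2) * P.L : ℕ) : ℝ) := by rw [hK₁]; ring
  · obtain rfl : j₀' = j₀ := D.lamSite_iterBlockOf_unique hj₀' hj₀
    exact hct x hx

end Support

/-! ## §2  Territories of lattice neighbours differ by at most one (collar property) -/

section Territory

/-- Iterated blocks of lattice neighbours are equal or adjacent (in the same direction), at every level of the standing range. [cite: Balaban1987RG1, (0.3) p.252] -/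
theorem iterBlockOf_adjacent {x z : Site P 0} {μ : Fin P.d} (h : z = x.shift μ) :
    ∀ (i : ℕ), i ≤ P.m + P.K → iterBlockOf i z = iterBlockOf i x ∨ iterBlockOf i z = (iterBlockOf i x).shift μ
  | 0, _ => Or.inr (by rw [iterBlockOf_zero, iterBlockOf_zero, h])
  | i + 1, hi => by
    rw [iterBlockOf_succ, iterBlockOf_succ]
    rcases iterBlockOf_adjacent h i (by omega) with e | e
    · exact Or.inl (by rw [e])
    · rw [e, B10StarCount.blockOf_shift hi]
      split_ifs
      · exact Or.inr rfl
      · exact Or.inl rfl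

variable (D : Domains P)
  (hcollar : ∀ (i : ℕ) (e : PBond P (i + 1)), D.LamBond (i + 1) e → ∀ z : Site P i, (blockOf z = e.src ∨ blockOf z = e.tgt) → z ∈ D.Om i)

include hcollar in
/-- ★ **TERRITORIES OF LATTICE NEIGHBOURS DIFFER BY AT MOST ONE** (collar property): if `B^a(x) ∈ Λ_a`, `B^b(z) ∈ Λ_b` and `z`, `x` are lattice neighbours then `b ≤ a + 1`
— else `B^{a+1}(z) ∈ Ω_{a+1}` would be deep next to `B^{a+1}(x) ∉ Ω_{a+1}`, against the boundary lemma. [cite: Balaban1984PropagatorsII, (2.1)-(2.4) p.224] -/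
theorem territory_le_succ_of_adjacent {x z : Site P 0} {μ : Fin P.d} (h : z = x.shift μ ∨ x = z.shift μ)
    {a b : ℕ} (ha : D.LamSite a (iterBlockOf a x)) (hb : D.LamSite b (iterBlockOf b z)) : b ≤ a + 1 := by
  by_contra hlt
  have hbk : b ≤ D.k := D.le_of_lamSite hb
  have hP : a + 1 ≤ P.m + P.K := by have := D.hk; omega
  have hz2 : D.InOm (a + 2) z := inOm_of_le_depth D hb (by omega)
  have hz1 : D.InOm (a + 1) z := inOm_of_le_depth D hb (by omega)
  have hx1 : ¬ D.InOm (a + 1) x := not_inOm_of_depth_lt D ha (by omega)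
  have hW : iterBlockOf (a + 1) z ∈ D.Om (a + 1) := hz1
  have hW₁ : iterBlockOf (a + 1) x ∉ D.Om (a + 1) := hx1
  have hne : iterBlockOf (a + 1) x ≠ iterBlockOf (a + 1) z := fun e => hW₁ (e ▸ hW)
  have hadj : iterBlockOf (a + 1) x = (iterBlockOf (a + 1) z).shift μ ∨ iterBlockOf (a + 1) z = (iterBlockOf (a + 1) x).shift μ := by
    rcases h with e | e
    · rcases iterBlockOf_adjacent e (a + 1) hP with h1 | h1
      · exact absurd h1.symm hne
      · exact Or.inr h1
    · rcases iterBlockOf_adjacent e (a + 1) hP with h1 | h1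
      · exact absurd h1 hne
      · exact Or.inl h1
  have hnd := not_deep_of_adjacent_not_mem D hcollar D.k (a + 1) (Nat.le_add_left _ _) _ _ μ hW hW₁ hadj
  exact hnd ((D.deep_iterBlockOf_iff (a + 1) z).2 hz2)

include hcollar in
/-- … in the `levOf` letters of the (98)∕(152) weights (`levOf` over the family's regions = the territory, UST `FlatCubeLevels.levOf_inOm_eq_iff`): for lattice neighbours
`levOf(z) ≤ levOf(x) + 1`. [cite: Balaban1984PropagatorsII, (2.4) p.224; Balaban1985Variational, (98) p.292] -/
theorem levOf_le_succ_of_adjacent {x z : Site P 0} {μ : Fin P.d} (h : z = x.shift μ ∨ x = z.shift μ) :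
    levOf (fun i => {y : Site P 0 | D.InOm i y}) D.k z ≤ levOf (fun i => {y : Site P 0 | D.InOm i y}) D.k x + 1 :=
  territory_le_succ_of_adjacent D hcollar h ((FlatCubeLevels.levOf_inOm_eq_iff D x _).1 rfl) ((FlatCubeLevels.levOf_inOm_eq_iff D z _).1 rfl)

end Territory

end Summit.QuantumFields.YangMills.Theorems.K0Stub1ColumnTerritory

end
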